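import Summits.HubbardSuperconductivity.HubbardSuperconductivity.Theorems.AnisotropyChordTransferFerroGapReduction
import Summits.HubbardSuperconductivity.HubbardSuperconductivity.Theorems.AnisotropyChordTransferTorusPoincare

/-!
# Route `AnisotropyChord` / H0 rotor rung, route (1): DEGREE-ONE DUALITY OF THE EXCLUSION GENERATOR — one-body
# (density-wave) amplitudes are mapped to one-body amplitudes; the cosine wave is an exact eigenvector at `1 − cos(2π/L)`

Degree-one self-duality of the symmetric exclusion process (Liggett 1985, VIII.1): the generator `A = ½ Σ_{edges}(1 − T_xy)`
(tree `fmOp`) maps a one-body amplitude `σ ↦ Σ_x f(x) n_x(σ)` (restricted to a particle-number sector) to the one-body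
amplitude of `½ Δ⁻ f`, `(Δ⁻ f)(x) = Σ_{y ∼ x} (f x − f y)`:

* `oneBody_sub_swap` — `s_f(σ) − s_f(σ ∘ (x y)) = (n_x − n_y)(σ)(f x − f y)` (`n_x = 1 − σ_x`);
* `fmOp_oneBody` — `A (χ · s_f) = χ · ½ Σ_x n_x (Δ⁻ f)(x)` for any sector function `χ` (general finite graph);
* `sum_adj_torus_eq_four` — on `(ℤ/L)²`, `L ≥ 3`, `Σ_y [x ∼ y] F y = Σᵢ (F(x + eᵢ) + F(x − eᵢ))`;
* `fmOp_cosWave_one` — on the torus, with `f = Re χ_k`, `k = e₀`, the sector-restricted density wave is an EXACT eigenvector of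
  `A` with eigenvalue `1 − cos(2π/L)` (the one-magnon gap) in every sector;

Used by `…TransferFerroGapSharp` (`sectorGapAtLeast_one_le`: the Temple-form sector gap of `H(1)` is `≤ 1 − cos(2π/L)` in every
non-trivial sector, so `FerroSectorGapCLR` is sharp).

Prover seat `hubbard-h0-rotor-p1` g20; helper for the S-bridge dossier of stmt-HubbardSuperconductivity-19089.  No definition is
introduced; nothing here is a statement about the Hubbard model.  Liggett, *Interacting Particle Systems* (1985) VIII.1
(duality); Caputo–Liggett–Richthammer (2010) §1.2.
-/

set_option linter.dupNamespace false
set_option autoImplicit false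

noncomputable section

open Finset Complex
open scoped ComplexConjugate
open Literature.MathematicalPhysics.QuantumLattice Literature.Probability.LatticeModels
open Summit.HubbardSuperconductivity.HubbardSuperconductivity.Theorems.AnisotropyChord.InsertionEntropy
open Summit.HubbardSuperconductivity.HubbardSuperconductivity.Theorems.AnisotropyChord.Tower

namespace Summit.HubbardSuperconductivity.HubbardSuperconductivity.Theorems.AnisotropyChord.Transfer

/-! ## One-body amplitudes under site transpositions (general finite vertex set) -/

section General

variable {V : Type} [Fintype V] [DecidableEq V]

/-- **one-body amplitudes under a transposition:** with the particle indicator `n_z(σ) = 1 − σ_z` and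
`s_f(σ) = Σ_z n_z(σ) f z`, `s_f(σ) − s_f(σ ∘ (x y)) = (σ_y − σ_x) (f x − f y)`. [folklore] -/
theorem oneBody_sub_swap (f : V → ℝ) (σ : V → Fin 2) (x y : V) :
    (∑ z, (1 - ((σ z : ℕ) : ℝ)) * f z) - (∑ z, (1 - (((σ ∘ ⇑(Equiv.swap x y)) z : ℕ) : ℝ)) * f z)
      = (((σ y : ℕ) : ℝ) - ((σ x : ℕ) : ℝ)) * (f x - f y) := by
  by_cases hxy : x = y
  · subst hxy
    simp [Equiv.swap_self]
  -- re-index the second sum by the involution `swap x y`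
  have hre : (∑ z, (1 - (((σ ∘ ⇑(Equiv.swap x y)) z : ℕ) : ℝ)) * f z)
      = ∑ z, (1 - ((σ z : ℕ) : ℝ)) * f (Equiv.swap x y z) :=
    Fintype.sum_equiv (Equiv.swap x y) _ _ fun z => by
      simp only [Function.comp_apply, Equiv.swap_apply_self]
  rw [hre, ← Finset.sum_sub_distrib]
  rw [Fintype.sum_eq_add x y hxy (fun z hz => by
    rw [Equiv.swap_apply_of_ne_of_ne hz.1 hz.2]; ring)]
  rw [Equiv.swap_apply_left, Equiv.swap_apply_right]
  ring

variable (G : SimpleGraph V) [DecidableRel G.Adj]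

/-- **degree-one duality of the exclusion generator:** for a sector function `χ` and `f : V → ℝ`,
`A (σ ↦ χ(N(σ)) s_f(σ)) (σ) = χ(N(σ)) · ½ Σ_x n_x(σ) Σ_y [x ∼ y] (f x − f y)`. [folklore] -/
theorem fmOp_oneBody (χ : ℝ → ℝ) (f : V → ℝ) (σ : V → Fin 2) :
    fmOp G (fun τ => χ (zerosCard τ) * ∑ z, (1 - ((τ z : ℕ) : ℝ)) * f z) σ
      = χ (zerosCard σ) * ((1 / 2 : ℝ) * ∑ x, (1 - ((σ x : ℕ) : ℝ))
          * ∑ y, if G.Adj x y then (f x - f y) else 0) := by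
  unfold fmOp
  have hterm : ∀ x y : V, (if G.Adj x y then
      (χ (zerosCard σ) * ∑ z, (1 - ((σ z : ℕ) : ℝ)) * f z)
        - (χ (zerosCard (σ ∘ ⇑(Equiv.swap x y))) * ∑ z, (1 - (((σ ∘ ⇑(Equiv.swap x y)) z : ℕ) : ℝ)) * f z)
      else 0)
      = χ (zerosCard σ) * ((if G.Adj x y then (1 - ((σ x : ℕ) : ℝ)) * (f x - f y) else 0)
        - (if G.Adj x y then (1 - ((σ y : ℕ) : ℝ)) * (f x - f y) else 0)) := by
    intro x y
    by_cases h : G.Adj x y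
    · rw [if_pos h, if_pos h, if_pos h, zerosCard_comp_perm, ← mul_sub, oneBody_sub_swap]
      ring
    · rw [if_neg h, if_neg h, if_neg h]
      ring
  simp_rw [hterm]
  simp_rw [← Finset.mul_sum]
  rw [show ∀ u v : ℝ, (1 / 4 : ℝ) * (u * v) = u * ((1 / 4 : ℝ) * v) from fun u v => by ring]
  congr 1
  simp only [Finset.sum_sub_distrib]
  -- the second double sum is minus the first (rename and use the symmetry of adjacency)
  have hswap : ∑ x, ∑ y, (if G.Adj x y then (1 - ((σ y : ℕ) : ℝ)) * (f x - f y) else 0)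
      = -∑ x, ∑ y, (if G.Adj x y then (1 - ((σ x : ℕ) : ℝ)) * (f x - f y) else 0) := by
    rw [Finset.sum_comm, ← Finset.sum_neg_distrib]
    refine Finset.sum_congr rfl fun x _ => ?_
    rw [← Finset.sum_neg_distrib]
    refine Finset.sum_congr rfl fun y _ => ?_
    by_cases h : G.Adj x y
    · rw [if_pos h, if_pos (G.adj_symm h)]
      ring
    · rw [if_neg h, if_neg (fun h' => h (G.adj_symm h'))]
      ring
  rw [hswap, sub_neg_eq_add, ← two_mul]
  have hfac : ∀ x, ∑ y, (if G.Adj x y then (1 - ((σ x : ℕ) : ℝ)) * (f x - f y) else 0)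
      = (1 - ((σ x : ℕ) : ℝ)) * ∑ y, (if G.Adj x y then (f x - f y) else 0) := by
    intro x
    rw [Finset.mul_sum]
    refine Finset.sum_congr rfl fun y _ => ?_
    split_ifs <;> ring
  simp_rw [hfac]
  ring

end General

/-! ## The torus: the four neighbours, and the cosine wave -/

variable {L : ℕ} [NeZero L]

/-- **exact neighbour sum on `(ℤ/L)²`, `L ≥ 3`:** `Σ_y [x ∼ y] F y = Σᵢ (F(x + eᵢ) + F(x − eᵢ))`. [folklore] -/
theorem sum_adj_torus_eq_four (hL : 3 ≤ L) (x : TorusSite 2 L) (F : TorusSite 2 L → ℝ) :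
    ∑ y, (if (torusGraph 2 L).Adj x y then F y else 0)
      = ∑ i : Fin 2, (F (x + Pi.single i 1) + F (x - Pi.single i 1)) := by
  classical
  have hL2 : 2 ≤ L := by omega
  haveI : Fact (1 < L) := ⟨by omega⟩
  -- `eᵢ + eⱼ ≠ 0` for `L ≥ 3`
  have hee : ∀ i j : Fin 2, (Pi.single i 1 : TorusSite 2 L) + Pi.single j 1 ≠ 0 := by
    intro i j h
    have hi := congrFun h i
    by_cases hij : j = i
    · subst hij
      simp only [Pi.add_apply, Pi.single_eq_same, Pi.zero_apply] at hi
      have h2 : ((2 : ℕ) : ZMod L) = 0 := by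
        have : (1 : ZMod L) + 1 = ((2 : ℕ) : ZMod L) := by norm_num
        rw [this] at hi
        exact hi
      rw [ZMod.natCast_eq_zero_iff] at h2
      have := Nat.le_of_dvd (by norm_num) h2
      omega
    · simp only [Pi.add_apply, Pi.single_eq_same, Pi.single_eq_of_ne (Ne.symm hij), Pi.zero_apply,
        add_zero] at hi
      exact one_ne_zero hi
  have hpm : ∀ i j : Fin 2, x + Pi.single i 1 ≠ x - Pi.single j (1 : ZMod L) := by
    intro i j h
    apply hee i j
    have h2 : x + (Pi.single i 1 + Pi.single j 1) = x := by rw [← add_assoc, h, sub_add_cancel]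
    exact add_eq_left.mp h2
  have h13 : x + Pi.single (0 : Fin 2) (1 : ZMod L) ≠ x + Pi.single (1 : Fin 2) 1 := fun h =>
    absurd (single_inj_torus hL2 (add_left_cancel h)) (by decide)
  have h24 : x - Pi.single (0 : Fin 2) (1 : ZMod L) ≠ x - Pi.single (1 : Fin 2) 1 := fun h =>
    absurd (single_inj_torus hL2 (sub_right_inj.mp h)) (by decide)
  -- the neighbour set
  have hfilter : (Finset.univ.filter fun y => (torusGraph 2 L).Adj x y)
      = {x + Pi.single 0 1, x - Pi.single 0 1, x + Pi.single 1 1, x - Pi.single 1 1} := by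
    ext y
    simp only [Finset.mem_filter, Finset.mem_univ, true_and, Finset.mem_insert, Finset.mem_singleton]
    constructor
    · intro h
      obtain ⟨-, ⟨i, hi⟩ | ⟨i, hi⟩⟩ := (torusGraph_adj_iff x y).mp h
      · fin_cases i
        · exact Or.inl hi
        · exact Or.inr (Or.inr (Or.inl hi))
      · have hy : y = x - Pi.single i 1 := by rw [hi, add_sub_cancel_right]
        fin_cases i
        · exact Or.inr (Or.inl hy)
        · exact Or.inr (Or.inr (Or.inr hy))
    · rintro (h | h | h | h) <;> rw [h]
      · exact torusGraph_adj_add_single hL2 x 0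
      · exact adj_sub_single hL2 x 0
      · exact torusGraph_adj_add_single hL2 x 1
      · exact adj_sub_single hL2 x 1
  rw [← Finset.sum_filter, hfilter, Finset.sum_insert (by simp [hpm 0 0, h13, hpm 0 1]),
    Finset.sum_insert (by simp [Ne.symm (hpm 1 0), h24]), Finset.sum_insert (by simp [hpm 1 1]),
    Finset.sum_singleton, Fin.sum_univ_two]
  ring

/-- **the cosine wave is a Laplacian eigenfunction:** with `f = Re χ_k`, `k = e₀` (`f(x) = cos(2π x₀/L)`), for `L ≥ 3`
`Σ_y [x ∼ y] (f x − f y) = 2 (1 − cos(2π/L)) f x`. [folklore] -/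
theorem laplacian_cosWave (hL : 3 ≤ L) (x : TorusSite 2 L) :
    ∑ y, (if (torusGraph 2 L).Adj x y then
        ((torusChar (Pi.single 0 1) x).re - (torusChar (Pi.single 0 1) y).re) else 0)
      = 2 * (1 - Real.cos (2 * Real.pi / L)) * (torusChar (Pi.single 0 1) x).re := by
  have hL2 : 2 ≤ L := by omega
  haveI : Fact (1 < L) := ⟨by omega⟩
  set k : TorusSite 2 L := Pi.single 0 1 with hk
  rw [sum_adj_torus_eq_four hL x, Fin.sum_univ_two]
  -- the character along the two axes
  have hp0 : latticeMomentum L k 0 = 2 * Real.pi / L := by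
    simp only [latticeMomentum, hk, Pi.single_eq_same, ZMod.val_one]
    push_cast
    ring
  have hk1 : torusChar k (Pi.single 1 1) = 1 := by
    rw [torusChar_single hL2 k 1]
    have : latticeMomentum L k 1 = 0 := by
      simp [latticeMomentum, hk]
    rw [this]
    simp
  have hre0 : (torusChar k (Pi.single 0 1)).re = Real.cos (2 * Real.pi / L) := by
    rw [torusChar_single_re hL2 k 0, hp0]
  -- along axis 0: χ(x+e₀) + χ(x−e₀) = χ(x)·(χ(e₀) + conj χ(e₀)) = 2 cos(2π/L) χ(x)
  have h0 : (torusChar k (x + Pi.single 0 1)).re + (torusChar k (x - Pi.single 0 1)).re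
      = 2 * Real.cos (2 * Real.pi / L) * (torusChar k x).re := by
    rw [torusChar_add_right, torusChar_sub_right, ← Complex.add_re, ← mul_add, Complex.add_conj, hre0,
      mul_comm, Complex.re_ofReal_mul]
  -- along axis 1: χ(x ± e₁) = χ(x)
  have h1 : (torusChar k (x + Pi.single 1 1)).re + (torusChar k (x - Pi.single 1 1)).re
      = 2 * (torusChar k x).re := by
    rw [torusChar_add_right, torusChar_sub_right, hk1, map_one, mul_one, two_mul]
  -- assemble
  have e1 : ((torusChar k x).re - (torusChar k (x + Pi.single 0 1)).re
        + ((torusChar k x).re - (torusChar k (x - Pi.single 0 1)).re))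
      + ((torusChar k x).re - (torusChar k (x + Pi.single 1 1)).re
        + ((torusChar k x).re - (torusChar k (x - Pi.single 1 1)).re))
      = 4 * (torusChar k x).re
        - ((torusChar k (x + Pi.single 0 1)).re + (torusChar k (x - Pi.single 0 1)).re)
        - ((torusChar k (x + Pi.single 1 1)).re + (torusChar k (x - Pi.single 1 1)).re) := by ring
  rw [e1, h0, h1]
  ring

/-- **EXACT EIGENVECTOR:** in every sector `{zerosCard = n}` the sector-restricted density wave
`b(σ) = [N(σ) = n] Σ_x n_x(σ) cos(2π x₀/L)` satisfies `A b = (1 − cos(2π/L)) b` (`L ≥ 3`). [folklore] -/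
theorem fmOp_cosWave_one (hL : 3 ≤ L) (n : ℝ) (σ : TensorIndex (TorusSite 2 L) 2) :
    fmOp (torusGraph 2 L)
        (fun τ => (if zerosCard τ = n then (1:ℝ) else 0)
          * ∑ z, (1 - ((τ z : ℕ) : ℝ)) * (torusChar (Pi.single 0 1) z).re) σ
      = (1 - Real.cos (2 * Real.pi / L))
        * ((if zerosCard σ = n then (1:ℝ) else 0)
          * ∑ z, (1 - ((σ z : ℕ) : ℝ)) * (torusChar (Pi.single 0 1) z).re) := by
  rw [fmOp_oneBody (torusGraph 2 L) (fun r => if r = n then (1:ℝ) else 0)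
    (fun z => (torusChar (Pi.single 0 1) z).re) σ]
  simp_rw [laplacian_cosWave hL]
  have : ∀ x : TorusSite 2 L,
      (1 - ((σ x : ℕ) : ℝ)) * (2 * (1 - Real.cos (2 * Real.pi / L)) * (torusChar (Pi.single 0 1) x).re)
      = 2 * (1 - Real.cos (2 * Real.pi / L)) * ((1 - ((σ x : ℕ) : ℝ)) * (torusChar (Pi.single 0 1) x).re) := by
    intro x; ring
  simp_rw [this, ← Finset.mul_sum]
  ring

end Summit.HubbardSuperconductivity.HubbardSuperconductivity.Theorems.AnisotropyChord.Transfer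

end
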